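import Literature.Topology.FourManifolds.FishtailPolarForm
import HarnessLib

/-!
# Angular zone maps along a radial position function

Infrastructure for the explicit fishtail neighbourhood (R. Gompf, *More Cappell–Shaneson spheres
are standard*, Algebr. Geom. Topol. 10 (2010), proof of Thm 2.1 and Lemma 2.2; the named fact
`Literature.Topology.FourManifolds.gompf2010_framedTwist`). The tube about Gompf's disc `D` is a
function of the complex coordinate `ζ` of `D` (`r = ‖ζ‖` the position, `arg ζ` the angle) and the
offset. Its pieces are angular zone maps `F (pos, ϑ, a, b)`, `2π`-periodic in `ϑ`, composed with a
radial position function: this file generalises `polarForm` (`FishtailPolarForm.lean`, where the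
position is the latitude `capN`) to an arbitrary smooth position function of the radius.

* `Literature.Topology.FourManifolds.normArgChart` — `ζ ↦ (‖ζ‖, arg ζ)` as a partial diffeomorphism
  of the slit plane onto `(0, ∞) × (-π, π)`;
* `Literature.Topology.FourManifolds.radialForm pos F (ζ, a, b) = F (pos ‖ζ‖, arg ζ, a, b)` with
  `isLocalDiffeomorphAt_radialForm` (at `ζ ≠ 0`, `pos' (‖ζ‖) ≠ 0`, `F` periodic and a local
  diffeomorphism at the point) and `contMDiffAt_radialForm`;
* `Literature.Topology.FourManifolds.radMapW P (ζ, w) = (P ‖ζ‖ e^{i arg ζ}, w)` — the radial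
  reparametrisation of the plane (carrying the offset), a local diffeomorphism where `P ≠ 0`,
  `P' ≠ 0` (`isLocalDiffeomorphAt_radMapW`).

Everything is proved; no named facts.

## References

* R. E. Gompf, *More Cappell–Shaneson spheres are standard*, Algebr. Geom. Topol. 10 (2010)
  1665–1681, proof of Thm 2.1 and Lemma 2.2. [GompfAGT2010]
-/

noncomputable section

open scoped Real ContDiff Topology Manifold
open Set Function Filter Complex

namespace Literature.Topology.FourManifolds

/-! ### `ζ ↦ (‖ζ‖, arg ζ)` -/

section NormArg

/-- **Polar coordinates of the slit plane** as a partial diffeomorphism `ℂ ⇀ ℝ × ℝ`. [folklore] -/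
def normArgChart : PartialDiffeomorph 𝓘(ℝ, ℂ) 𝓘(ℝ, ℝ × ℝ) ℂ (ℝ × ℝ) ∞ where
  toFun ζ := (‖ζ‖, arg ζ)
  invFun p := (p.1 : ℂ) * exp (p.2 * I)
  source := slitPlane
  target := {p | 0 < p.1 ∧ -π < p.2 ∧ p.2 < π}
  map_source' ζ hζ := by
    refine ⟨norm_pos_iff.2 (slitPlane_ne_zero hζ), neg_pi_lt_arg ζ, ?_⟩
    exact lt_of_le_of_ne (arg_le_pi ζ) (fun h ↦ by rw [mem_slitPlane_iff_arg] at hζ; exact hζ.1 h)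
  map_target' p hp := by
    rw [mem_slitPlane_iff_arg]
    have harg : arg ((p.1 : ℂ) * exp (p.2 * I)) = p.2 := by
      rw [arg_real_mul _ hp.1]
      have := arg_exp_mul_I_eq (ϑ := p.2) (k := 0) (by simp; linarith [hp.2.1]) (by simp; linarith [hp.2.2])
      simpa using this
    refine ⟨by rw [harg]; exact hp.2.2.ne, ?_⟩
    exact mul_ne_zero (ofReal_ne_zero.2 hp.1.ne') (exp_ne_zero _)
  left_inv' ζ _ := norm_mul_exp_arg_mul_I ζ
  right_inv' p hp := by
    have hp1 : 0 < p.1 := hp.1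
    refine Prod.ext ?_ ?_
    · show ‖(p.1 : ℂ) * exp (p.2 * I)‖ = p.1
      rw [norm_mul, norm_exp_ofReal_mul_I, mul_one, norm_real, Real.norm_of_nonneg hp1.le]
    · show arg ((p.1 : ℂ) * exp (p.2 * I)) = p.2
      rw [arg_real_mul _ hp1]
      have := arg_exp_mul_I_eq (ϑ := p.2) (k := 0) (by simp; linarith [hp.2.1]) (by simp; linarith [hp.2.2])
      simpa using this
  open_source := isOpen_slitPlane
  open_target := (isOpen_lt continuous_const continuous_fst).and
    ((isOpen_lt continuous_const continuous_snd).and (isOpen_lt continuous_snd continuous_const))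
  contMDiffOn_toFun := by
    intro ζ hζ
    refine ContMDiffAt.contMDiffWithinAt (contMDiffAt_iff_contDiffAt.2 ?_)
    exact (contDiffAt_norm ℝ (slitPlane_ne_zero hζ)).prodMk (contDiffAt_arg hζ)
  contMDiffOn_invFun := by
    refine (contMDiff_iff_contDiff.2 ?_).contMDiffOn
    exact (ofRealCLM.contDiff.comp contDiff_fst).mul (Complex.contDiff_exp.comp ((ofRealCLM.contDiff.comp contDiff_snd).mul contDiff_const))

/-- The value of the chart. [folklore] -/
@[simp] theorem normArgChart_apply (ζ : ℂ) : normArgChart ζ = (‖ζ‖, arg ζ) := rfl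

/-- `ζ ↦ (‖ζ‖, arg ζ)` is a local diffeomorphism on the slit plane. [folklore] -/
theorem isLocalDiffeomorphAt_norm_arg {ζ : ℂ} (hζ : ζ ∈ slitPlane) :
    IsLocalDiffeomorphAt 𝓘(ℝ, ℂ) 𝓘(ℝ, ℝ × ℝ) ∞ (fun ζ ↦ (‖ζ‖, arg ζ)) ζ :=
  PartialDiffeomorph.isLocalDiffeomorphAt 𝓘(ℝ, ℂ) 𝓘(ℝ, ℝ × ℝ) ∞ normArgChart hζ

variable {pos : ℝ → ℝ}

/-- `ζ ↦ (pos ‖ζ‖, arg ζ)` is a local diffeomorphism on the slit plane when `pos` is smooth near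
`‖ζ‖` with nonzero derivative. [folklore] -/
theorem isLocalDiffeomorphAt_pos_arg {ζ : ℂ} (hζ : ζ ∈ slitPlane) (hpos : ∀ᶠ t in 𝓝 ‖ζ‖, ContDiffAt ℝ ∞ pos t)
    (hder : deriv pos ‖ζ‖ ≠ 0) :
    IsLocalDiffeomorphAt 𝓘(ℝ, ℂ) 𝓘(ℝ, ℝ × ℝ) ∞ (fun ζ ↦ (pos ‖ζ‖, arg ζ)) ζ := by
  have h1 := isLocalDiffeomorphAt_norm_arg hζ
  -- `(ρ, θ) ↦ (pos ρ, θ)` as `swap ∘ graph ∘ swap`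
  obtain ⟨U, hU, hUo, hmem⟩ : ∃ U : Set ℝ, (∀ t ∈ U, ContDiffAt ℝ ∞ pos t) ∧ IsOpen U ∧ ‖ζ‖ ∈ U := by
    obtain ⟨U, hU, hUo, hq⟩ := _root_.mem_nhds_iff.1 hpos
    exact ⟨U, fun t ht ↦ hU ht, hUo, hq⟩
  have hG : IsLocalDiffeomorphAt 𝓘(ℝ, ℝ × ℝ) 𝓘(ℝ, ℝ × ℝ) ∞ (fun p : ℝ × ℝ ↦ (p.1, pos p.2)) (arg ζ, ‖ζ‖) := by
    have hf : ContDiffOn ℝ ∞ (fun p : ℝ × ℝ ↦ pos p.2) {p | p.2 ∈ U} := fun p hp ↦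
      ((hU _ hp).comp p contDiffAt_snd).contDiffWithinAt
    have hd : HasDerivAt pos (deriv pos ‖ζ‖) ‖ζ‖ := ((hU _ hmem).differentiableAt (by simp)).hasDerivAt
    exact isLocalDiffeomorphAt_graph_real (hUo.preimage continuous_snd) (show (arg ζ, ‖ζ‖) ∈ {p : ℝ × ℝ | p.2 ∈ U} from hmem)
      hf (by exact_mod_cast le_top) hder hd
  have hS1 := (ContinuousLinearEquiv.prodComm ℝ ℝ ℝ).toDiffeomorph.isLocalDiffeomorph (‖ζ‖, arg ζ)
  have hS2 := (ContinuousLinearEquiv.prodComm ℝ ℝ ℝ).toDiffeomorph.isLocalDiffeomorph (arg ζ, pos ‖ζ‖)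
  have h := ((h1.comp (K := 𝓘(ℝ, ℝ × ℝ)) (P := ℝ × ℝ) hS1).comp (K := 𝓘(ℝ, ℝ × ℝ)) (P := ℝ × ℝ) hG).comp
    (K := 𝓘(ℝ, ℝ × ℝ)) (P := ℝ × ℝ) hS2
  exact isLocalDiffeomorphAt_congr_nhds' h (Eventually.of_forall fun ζ' ↦ rfl)

end NormArg

/-! ### The radial form -/

section RadialForm

variable (pos : ℝ → ℝ) {M : Type*} (F : ℝ × ℝ × ℝ × ℝ → M)

/-- **The radial form of an angular zone map**: `(ζ, a, b) ↦ F (pos ‖ζ‖, arg ζ, a, b)`. [folklore] -/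
def radialForm (q : ℂ × ℝ × ℝ) : M := F (pos ‖q.1‖, arg q.1, q.2)

variable {pos F}

/-- The value of the radial form. [folklore] -/
theorem radialForm_apply (q : ℂ × ℝ × ℝ) : radialForm pos F q = F (pos ‖q.1‖, arg q.1, q.2) := rfl

/-- Near the slit the angle may be read off `-ζ` (for `F` `2π`-periodic in the angle). [folklore] -/
theorem radialForm_eventuallyEq_neg (hper : ∀ n ϑ (w : ℝ × ℝ), F (n, ϑ + 2 * π, w) = F (n, ϑ, w)) {q : ℂ × ℝ × ℝ}
    (hre : q.1.re < 0) :
    radialForm pos F =ᶠ[𝓝 q] fun q' ↦ F (pos ‖q'.1‖, arg (-q'.1) + π, q'.2) := by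
  have ho : IsOpen {q' : ℂ × ℝ × ℝ | q'.1.re < 0} := isOpen_lt (continuous_re.comp continuous_fst) continuous_const
  filter_upwards [ho.mem_nhds hre] with q' hq'
  simp only [radialForm]
  have hq'' : q'.1.re < 0 := hq'
  rcases lt_trichotomy q'.1.im 0 with him | him | him
  · rw [arg_neg_eq_arg_add_pi_of_im_neg him, show arg q'.1 + π + π = arg q'.1 + 2 * π by ring, hper]
  · have hd : q'.1 = ((q'.1.re : ℝ) : ℂ) := Complex.ext (by simp) (by simp [him])
    have h1 : arg q'.1 = π := by rw [hd]; exact arg_ofReal_of_neg hq''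
    have h2 : arg (-q'.1) = 0 := by
      rw [hd, ← ofReal_neg]; exact arg_ofReal_of_nonneg (by linarith)
    rw [h1, h2, zero_add]
  · rw [arg_neg_eq_arg_sub_pi_of_im_pos him, sub_add_cancel]

variable {E H : Type*} [NormedAddCommGroup E] [NormedSpace ℝ E] [TopologicalSpace H] {J : ModelWithCorners ℝ E H}
  [TopologicalSpace M] [ChartedSpace H M]

/-- `(ζ, a, b) ↦ (pos ‖ζ‖, arg ζ, a, b)` is a local diffeomorphism on the slit plane. [folklore] -/
theorem isLocalDiffeomorphAt_pos_arg_prod {q : ℂ × ℝ × ℝ} (hζ : q.1 ∈ slitPlane)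
    (hpos : ∀ᶠ t in 𝓝 ‖q.1‖, ContDiffAt ℝ ∞ pos t) (hder : deriv pos ‖q.1‖ ≠ 0) :
    IsLocalDiffeomorphAt 𝓘(ℝ, ℂ × ℝ × ℝ) 𝓘(ℝ, ℝ × ℝ × ℝ × ℝ) ∞ (fun q : ℂ × ℝ × ℝ ↦ (pos ‖q.1‖, arg q.1, q.2)) q := by
  have h : IsLocalDiffeomorphAt 𝓘(ℝ, ℂ × ℝ × ℝ) 𝓘(ℝ, (ℝ × ℝ) × (ℝ × ℝ)) ∞
      (fun q : ℂ × ℝ × ℝ ↦ ((pos ‖q.1‖, arg q.1), q.2)) q := by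
    have h := IsLocalDiffeomorphAt.prodMap' (isLocalDiffeomorphAt_pos_arg hζ hpos hder)
      ((Diffeomorph.refl 𝓘(ℝ, ℝ × ℝ) (ℝ × ℝ) ∞).isLocalDiffeomorph q.2)
    rw [← modelWithCornersSelf_prod, ← modelWithCornersSelf_prod, chartedSpaceSelf_prod, chartedSpaceSelf_prod] at h
    exact h
  let R : ((ℝ × ℝ) × (ℝ × ℝ)) ≃ₘ⟮𝓘(ℝ, (ℝ × ℝ) × (ℝ × ℝ)), 𝓘(ℝ, ℝ × ℝ × ℝ × ℝ)⟯ (ℝ × ℝ × ℝ × ℝ) :=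
    { toFun := fun p ↦ (p.1.1, p.1.2, p.2)
      invFun := fun p ↦ ((p.1, p.2.1), p.2.2)
      left_inv := fun _ ↦ rfl
      right_inv := fun _ ↦ rfl
      contMDiff_toFun := contMDiff_iff_contDiff.2 ((contDiff_fst.comp contDiff_fst).prodMk
        ((contDiff_snd.comp contDiff_fst).prodMk contDiff_snd))
      contMDiff_invFun := contMDiff_iff_contDiff.2 ((contDiff_fst.prodMk (contDiff_fst.comp contDiff_snd)).prodMk
        (contDiff_snd.comp contDiff_snd)) }
  have hR := R.isLocalDiffeomorph ((pos ‖q.1‖, arg q.1), q.2)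
  have h' := h.comp (K := 𝓘(ℝ, ℝ × ℝ × ℝ × ℝ)) (P := ℝ × ℝ × ℝ × ℝ) hR
  exact isLocalDiffeomorphAt_congr_nhds' h' (Eventually.of_forall fun q' ↦ rfl)

/-- The same read off `-ζ`. [folklore] -/
theorem isLocalDiffeomorphAt_pos_arg_neg_prod {q : ℂ × ℝ × ℝ} (hζ : -q.1 ∈ slitPlane)
    (hpos : ∀ᶠ t in 𝓝 ‖q.1‖, ContDiffAt ℝ ∞ pos t) (hder : deriv pos ‖q.1‖ ≠ 0) :
    IsLocalDiffeomorphAt 𝓘(ℝ, ℂ × ℝ × ℝ) 𝓘(ℝ, ℝ × ℝ × ℝ × ℝ) ∞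
      (fun q : ℂ × ℝ × ℝ ↦ (pos ‖q.1‖, arg (-q.1) + π, q.2)) q := by
  let Ng : (ℂ × ℝ × ℝ) ≃ₘ⟮𝓘(ℝ, ℂ × ℝ × ℝ), 𝓘(ℝ, ℂ × ℝ × ℝ)⟯ (ℂ × ℝ × ℝ) :=
    { toFun := fun q ↦ (-q.1, q.2)
      invFun := fun q ↦ (-q.1, q.2)
      left_inv := fun q ↦ by simp
      right_inv := fun q ↦ by simp
      contMDiff_toFun := contMDiff_iff_contDiff.2 (contDiff_fst.neg.prodMk contDiff_snd)
      contMDiff_invFun := contMDiff_iff_contDiff.2 (contDiff_fst.neg.prodMk contDiff_snd) }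
  let Sh : (ℝ × ℝ × ℝ × ℝ) ≃ₘ⟮𝓘(ℝ, ℝ × ℝ × ℝ × ℝ), 𝓘(ℝ, ℝ × ℝ × ℝ × ℝ)⟯ (ℝ × ℝ × ℝ × ℝ) :=
    { toFun := fun p ↦ (p.1, p.2.1 + π, p.2.2)
      invFun := fun p ↦ (p.1, p.2.1 - π, p.2.2)
      left_inv := fun p ↦ by simp
      right_inv := fun p ↦ by simp
      contMDiff_toFun := contMDiff_iff_contDiff.2 (contDiff_fst.prodMk
        (((contDiff_fst.comp contDiff_snd).add contDiff_const).prodMk (contDiff_snd.comp contDiff_snd)))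
      contMDiff_invFun := contMDiff_iff_contDiff.2 (contDiff_fst.prodMk
        (((contDiff_fst.comp contDiff_snd).sub contDiff_const).prodMk (contDiff_snd.comp contDiff_snd))) }
  have h1 := Ng.isLocalDiffeomorph q
  have h2 := isLocalDiffeomorphAt_pos_arg_prod (pos := pos) (q := (-q.1, q.2)) hζ (by simpa using hpos) (by simpa using hder)
  have h3 := Sh.isLocalDiffeomorph (pos ‖-q.1‖, arg (-q.1), q.2)
  have h := (h1.comp (K := 𝓘(ℝ, ℝ × ℝ × ℝ × ℝ)) (P := ℝ × ℝ × ℝ × ℝ) h2).comp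
    (K := 𝓘(ℝ, ℝ × ℝ × ℝ × ℝ)) (P := ℝ × ℝ × ℝ × ℝ) h3
  refine isLocalDiffeomorphAt_congr_nhds' h (Eventually.of_forall fun q' ↦ ?_)
  show (pos ‖q'.1‖, arg (-q'.1) + π, q'.2) = (pos ‖-q'.1‖, arg (-q'.1) + π, q'.2)
  rw [norm_neg]

/-- **The radial form is a local diffeomorphism** at `(ζ, a, b)`, `ζ ≠ 0`, when `pos` is smooth near
`‖ζ‖` with nonzero derivative, `F` is `2π`-periodic in the angle and a local diffeomorphism at
`(pos ‖ζ‖, arg ζ, a, b)`. [folklore] -/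
theorem isLocalDiffeomorphAt_radialForm (hper : ∀ n ϑ (w : ℝ × ℝ), F (n, ϑ + 2 * π, w) = F (n, ϑ, w))
    {q : ℂ × ℝ × ℝ} (hd : q.1 ≠ 0) (hpos : ∀ᶠ t in 𝓝 ‖q.1‖, ContDiffAt ℝ ∞ pos t) (hder : deriv pos ‖q.1‖ ≠ 0)
    (hF : IsLocalDiffeomorphAt 𝓘(ℝ, ℝ × ℝ × ℝ × ℝ) J ∞ F (pos ‖q.1‖, arg q.1, q.2)) :
    IsLocalDiffeomorphAt 𝓘(ℝ, ℂ × ℝ × ℝ) J ∞ (radialForm pos F) q := by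
  by_cases hs : q.1 ∈ slitPlane
  · have h1 := isLocalDiffeomorphAt_pos_arg_prod (pos := pos) hs hpos hder
    have h := h1.comp (K := J) (P := M) hF
    exact isLocalDiffeomorphAt_congr_nhds' h (Eventually.of_forall fun q' ↦ rfl)
  · have hre : q.1.re < 0 := by
      rw [mem_slitPlane_iff, not_or, not_lt, not_ne_iff] at hs
      rcases hs.1.lt_or_eq with h | h
      · exact h
      · exfalso; exact hd (Complex.ext h (by simpa using hs.2))
    have him : q.1.im = 0 := by
      rw [mem_slitPlane_iff, not_or, not_lt, not_ne_iff] at hs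
      exact hs.2
    have hneg : -q.1 ∈ slitPlane := by
      rw [mem_slitPlane_iff]; left; simp; linarith
    have h1 := isLocalDiffeomorphAt_pos_arg_neg_prod (pos := pos) hneg hpos hder
    have hF' : IsLocalDiffeomorphAt 𝓘(ℝ, ℝ × ℝ × ℝ × ℝ) J ∞ F (pos ‖q.1‖, arg (-q.1) + π, q.2) := by
      rw [arg_neg_add_pi_of_slit hre him]; exact hF
    have h := h1.comp (K := J) (P := M) hF'
    exact isLocalDiffeomorphAt_congr_nhds' h (radialForm_eventuallyEq_neg hper hre)

end RadialForm

/-! ### The radial reparametrisation of the plane -/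

section RadMap

variable (P : ℝ → ℝ)

/-- **The radial reparametrisation** `(ζ, w) ↦ (P ‖ζ‖ e^{i arg ζ}, w)`. [folklore] -/
def radMapW (q : ℂ × ℝ × ℝ) : ℂ × ℝ × ℝ := ((P ‖q.1‖ : ℂ) * exp (arg q.1 * I), q.2)

variable {P}

/-- The value of `radMapW`. [folklore] -/
theorem radMapW_apply (q : ℂ × ℝ × ℝ) : radMapW P q = ((P ‖q.1‖ : ℂ) * exp (arg q.1 * I), q.2) := rfl

/-- The norm of the new position is `|P ‖ζ‖|`. [folklore] -/
theorem norm_radMapW_fst (q : ℂ × ℝ × ℝ) : ‖(radMapW P q).1‖ = |P ‖q.1‖| := by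
  rw [radMapW_apply]
  simp [norm_exp_ofReal_mul_I]

/-- `radMapW = radialForm P F₀` with `F₀ (ρ, θ, w) = (ρ e^{iθ}, w)`. [folklore] -/
theorem radMapW_eq (q : ℂ × ℝ × ℝ) :
    radMapW P q = radialForm P (fun p : ℝ × ℝ × ℝ × ℝ ↦ ((p.1 : ℂ) * exp (p.2.1 * I), p.2.2)) q := rfl

/-- `(ρ, θ, w) ↦ (ρ e^{iθ}, w)` is a local diffeomorphism where `ρ ≠ 0`. [folklore] -/
theorem isLocalDiffeomorphAt_polarW {p : ℝ × ℝ × ℝ × ℝ} (hρ : p.1 ≠ 0) :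
    IsLocalDiffeomorphAt 𝓘(ℝ, ℝ × ℝ × ℝ × ℝ) 𝓘(ℝ, ℂ × ℝ × ℝ) ∞
      (fun p : ℝ × ℝ × ℝ × ℝ ↦ ((p.1 : ℂ) * exp (p.2.1 * I), p.2.2)) p := by
  -- reorder to `((a, b), (ρ, θ))`, polar graph, then swap
  let R : (ℝ × ℝ × ℝ × ℝ) ≃ₘ⟮𝓘(ℝ, ℝ × ℝ × ℝ × ℝ), 𝓘(ℝ, (ℝ × ℝ) × (ℝ × ℝ))⟯ ((ℝ × ℝ) × (ℝ × ℝ)) :=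
    { toFun := fun p ↦ (p.2.2, (p.1, p.2.1))
      invFun := fun p ↦ (p.2.1, p.2.2, p.1)
      left_inv := fun _ ↦ rfl
      right_inv := fun _ ↦ rfl
      contMDiff_toFun := contMDiff_iff_contDiff.2 ((contDiff_snd.comp contDiff_snd).prodMk
        (contDiff_fst.prodMk (contDiff_fst.comp contDiff_snd)))
      contMDiff_invFun := contMDiff_iff_contDiff.2 ((contDiff_fst.comp contDiff_snd).prodMk
        ((contDiff_snd.comp contDiff_snd).prodMk contDiff_fst)) }
  have h1 := R.isLocalDiffeomorph p
  have h2 : IsLocalDiffeomorphAt 𝓘(ℝ, (ℝ × ℝ) × (ℝ × ℝ)) 𝓘(ℝ, (ℝ × ℝ) × ℂ) ∞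
      (fun r : (ℝ × ℝ) × (ℝ × ℝ) ↦ (r.1, polarC r.2)) (R p) := isLocalDiffeomorphAt_polarGraph (by exact hρ)
  have h3 := (ContinuousLinearEquiv.prodComm ℝ (ℝ × ℝ) ℂ).toDiffeomorph.isLocalDiffeomorph ((R p).1, polarC (R p).2)
  have h := (h1.comp (K := 𝓘(ℝ, (ℝ × ℝ) × ℂ)) (P := (ℝ × ℝ) × ℂ) h2).comp (K := 𝓘(ℝ, ℂ × (ℝ × ℝ))) (P := ℂ × (ℝ × ℝ)) h3
  exact isLocalDiffeomorphAt_congr_nhds' h (Eventually.of_forall fun p' ↦ rfl)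

/-- **The radial reparametrisation is a local diffeomorphism** at `(ζ, w)`, `ζ ≠ 0`, when `P` is
smooth near `‖ζ‖` with `P ‖ζ‖ ≠ 0` and `P' ‖ζ‖ ≠ 0`. [folklore] -/
theorem isLocalDiffeomorphAt_radMapW {q : ℂ × ℝ × ℝ} (hd : q.1 ≠ 0) (hpos : ∀ᶠ t in 𝓝 ‖q.1‖, ContDiffAt ℝ ∞ P t)
    (hP : P ‖q.1‖ ≠ 0) (hder : deriv P ‖q.1‖ ≠ 0) :
    IsLocalDiffeomorphAt 𝓘(ℝ, ℂ × ℝ × ℝ) 𝓘(ℝ, ℂ × ℝ × ℝ) ∞ (radMapW P) q := by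
  have h := isLocalDiffeomorphAt_radialForm (pos := P) (J := 𝓘(ℝ, ℂ × ℝ × ℝ))
    (F := fun p : ℝ × ℝ × ℝ × ℝ ↦ ((p.1 : ℂ) * exp (p.2.1 * I), p.2.2)) (fun n ϑ w ↦ by
      simp only [Prod.mk.injEq, and_true]
      rw [show ((ϑ + 2 * π : ℝ) : ℂ) * I = ϑ * I + 2 * π * I by push_cast; ring, Complex.exp_add, exp_two_pi_mul_I, mul_one])
    hd hpos hder (isLocalDiffeomorphAt_polarW (by exact hP))
  exact isLocalDiffeomorphAt_congr_nhds' h (Eventually.of_forall fun q' ↦ radMapW_eq q')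

end RadMap

end Literature.Topology.FourManifolds
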